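import Summits.Parity.GeneralizedHardyLittlewood.Theorems.LeeYangFibresAbsoluteUpgradeSinglesDecayScale
import HarnessLib

/-!
# Route `LeeYangFibres`, crux `AbsoluteUpgrade` (stmt-Parity-14116), line `nlc-cells-absolute-clip`:
# the stub `SinglesDecay` (registered stub `stub_singlesDecay`)

`SinglesDecay` (statement in `Theorems/LeeYangFibresAbsoluteUpgradeDefs.lean`): for `t` forms and size
`L` there is `c > 0` (here `c = 1/16`) such that for every `A`, uniformly for `N ≥ N₀`,
`4 ≤ u ≤ A log log log N`, non-degenerate `Ψ` with `‖Ψ‖_N ≤ L`, convex `K ⊆ [-N, N]` and every `i`,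

  `|∑_{n ∈ roughTuples Ψ K N u} (−1)^{Ω(ψ_i(n))}| ≤ C e^{−cu} β_∞(Ψ,K) ∏_p β_p(Ψ) (u/log N)^t + N/log^{t+1} N`.

Proof (all engines landed in helper files 1–10 of this line): the rough tuples are the rough points of
the integer interval `I` of positive lattice points of `K` (`#I ≤ β_∞ + 1`, `exists_interval`); a local
obstruction of `F_Ψ = ∏ ψ_k` at a prime `p ≤ L + t ≤ N^{1/u}` empties them; otherwise the root density
of `F_Ψ` has sieve dimension `2(L + t)` (`hasSieveDimension_sysPoly`) and
* for `u ≥ 17` (`singles_largeU`): the Fundamental Lemma (`SieveSequence.fundamental_lemma_uniform_holds`,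
  Friedlander–Iwaniec Cor. 6.10) at `z = ⌊N^{1/u}⌋ + 1 ≤ D = N^{1/8}` on the two sign classes of
  `λ(ψ_i(m))`, whose main terms cancel (`signed_sifted_sum_le`); `V(z) ≤ 2 ∏_p β_p (u/log N)^t`,
  `e^{−log D/log z} ≤ e^{−u/16}`;
* for `4 ≤ u ≤ 16` (`singles_smallU`): the number of `N^{1/17}`-sifted points;
* the remainder — Liouville sums over residue classes along `ψ_i`, weighted by root counts — is
  `≪ N/log^{t+3} N` by Bombieri–Vinogradov for `λ` (`classSums_le`, helper file 5; here `rem_le`);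
* the junk `t + 1 + 2C_FL + 2 L C_r N/log^{t+3} N ≤ N/log^{t+1} N` for large `N` (`eventually_junk`).
The constant is `C = 6 (1 + C_FL) 5^t`.  Unconditional; standard axioms.

References: J. Friedlander, H. Iwaniec, *Opera de Cribro* (2010), Cor. 6.10
[FriedlanderIwaniecOpera2010]; H. Iwaniec, E. Kowalski, *Analytic Number Theory* (2004), Thm. 17.4
[IwaniecKowalski2004]; B. Green, T. Tao, Ann. of Math. 171 (2010), §1 [GreenTao2010].
-/

noncomputable section

open Finset Polynomial ArithmeticFunction Filter

namespace Summit.Parity.GeneralizedHardyLittlewood.Theorems.AbsoluteUpgrade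

open Literature.NumberTheory.Sieve
open Summit.Parity.GeneralizedHardyLittlewood.Cruxes.AbsoluteUpgrade.NlcCellsAbsoluteClip

variable {t : ℕ}

/-! ### The remainder at one scale -/

/-- **The Liouville class sums along `ψ_i` at one scale** (from `classSums_le`, helper file 5 — Bombieri–
Vinogradov for `λ` over intervals): for `N` large (`x₀ ≤ N`, `L N^{1/8} ≤ (2LN)^{1/4}`, `log N ≥ 1`) and
the interval `I = [m₁, m₂] ⊆ [-N, N]` of points where every form is `≥ 1`,
`∑_{d ≤ N^{1/8} sqfree} ∑_{s root of F_Ψ mod d} (1 + |∑_{m ∈ I, m ≡ s (d)} λ(ψ_i(m))|) ≤ 2 L C_r N/(log N)^{t+3}`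
(`x = 2LN`, values `ψ_i(m) ≤ 2LN`, moduli `|a_i| d ≤ L N^{1/8} ≤ x^{1/4}`). [cite: IwaniecKowalski2004, Thm. 17.4] -/
theorem rem_le {Cr x₀ : ℝ} {L : ℕ}
    (hCr : ∀ x : ℝ, x₀ ≤ x → ∀ F : Polynomial ℤ, (∀ p : ℕ, p.Prime → polyRootCountMod ![F] p ≤ L + t) →
      ∀ (a b m₁ m₂ : ℤ), a ≠ 0 → m₁ ≤ m₂ → (∀ m ∈ Icc m₁ m₂, 1 ≤ a * m + b) →
        (∀ m ∈ Icc m₁ m₂, ((a * m + b : ℤ) : ℝ) ≤ x) →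
          ∀ Dn : ℕ, ((a.natAbs * Dn : ℕ) : ℝ) ≤ x ^ (1 / 4 : ℝ) →
          ∑ d ∈ (Icc 1 Dn).filter Squarefree, ∑ s ∈ rootsMod F d,
            (1 + |∑ m ∈ (Icc m₁ m₂).filter (fun m : ℤ => m ≡ (s : ℤ) [ZMOD d]),
              (liouville (a * m + b).toNat : ℝ)|) ≤ Cr * x / Real.log x ^ (t + 3))
    {Ψ : Fin t → AffLinForm 1} (hΨ : IsNondegenerateSystem Ψ) {N : ℕ} (hL : affLinSize Ψ N ≤ L)
    (h16 : (16 : ℝ) ≤ N) (hlog1 : 1 ≤ Real.log N) (hx₀ : x₀ ≤ N)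
    (hquarter : (L : ℝ) * (N : ℝ) ^ ((1 : ℝ) / 8) ≤ (2 * L * N) ^ ((1 : ℝ) / 4))
    {m₁ m₂ : ℤ} (hm : m₁ ≤ m₂)
    (hI : ∀ m : ℤ, m ∈ Icc m₁ m₂ → m ∈ Icc (-(N : ℤ)) N ∧ ∀ k, 1 ≤ (Ψ k).eval (fun _ => m))
    (i : Fin t) :
    ∑ d ∈ (Icc 1 ⌊(N : ℝ) ^ ((1 : ℝ) / 8)⌋₊).filter Squarefree, ∑ s ∈ rootsMod (sysPoly Ψ) d,
      (1 + |∑ m ∈ (Icc m₁ m₂).filter (fun m : ℤ => m ≡ (s : ℤ) [ZMOD d]),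
        (liouville ((Ψ i).coeff 0 * m + (Ψ i).const).toNat : ℝ)|) ≤
      2 * L * max Cr 0 * N / Real.log N ^ (t + 3) := by
  have hL1 : (1 : ℝ) ≤ L := one_le_of_affLinSize_le Ψ hΨ hL i
  have hNpos : (0 : ℝ) < N := by linarith
  have hN1r : (1 : ℝ) ≤ N := by linarith
  have hNnat : 1 ≤ N := by exact_mod_cast hN1r
  have hlogpos : 0 < Real.log N := by linarith
  have haL : ∀ k, ((Ψ k).coeff 0).natAbs ≤ L := fun k => natAbs_coeff_le_of_affLinSize_le hL k 0
  have hxN : (N : ℝ) ≤ 2 * L * N := by nlinarith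
  have hx : x₀ ≤ 2 * L * N := hx₀.trans hxN
  have hB : ∀ p : ℕ, p.Prime → polyRootCountMod ![sysPoly Ψ] p ≤ L + t := fun p hp =>
    rootCount_le_add hΨ haL hp
  have ha0 : (Ψ i).coeff 0 ≠ 0 := coeff_ne_zero_of_nondegenerate hΨ i
  have hab : ∀ m ∈ Icc m₁ m₂, 1 ≤ (Ψ i).coeff 0 * m + (Ψ i).const := fun m hm => by
    have := (hI m hm).2 i; rwa [DimOne.eval_eq] at this
  have hvals : ∀ m ∈ Icc m₁ m₂, (((Ψ i).coeff 0 * m + (Ψ i).const : ℤ) : ℝ) ≤ 2 * L * N := by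
    intro m hm
    have h := abs_eval_le_of_affLinSize_le (L := (L : ℝ)) hNnat hL (const_mem_latticeBox (hI m hm).1) i
    rw [DimOne.eval_eq] at h
    exact le_trans (le_abs_self _) (by exact_mod_cast h)
  have hDn : ((((Ψ i).coeff 0).natAbs * ⌊(N : ℝ) ^ ((1 : ℝ) / 8)⌋₊ : ℕ) : ℝ) ≤
      (2 * L * N) ^ ((1 : ℝ) / 4) := by
    push_cast
    calc (((Ψ i).coeff 0).natAbs : ℝ) * (⌊(N : ℝ) ^ ((1 : ℝ) / 8)⌋₊ : ℝ)
        ≤ (L : ℝ) * (N : ℝ) ^ ((1 : ℝ) / 8) :=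
          mul_le_mul (by exact_mod_cast haL i) (Nat.floor_le (by positivity)) (Nat.cast_nonneg _)
            (Nat.cast_nonneg _)
      _ ≤ _ := hquarter
  have h := hCr (2 * L * N) hx (sysPoly Ψ) hB _ _ m₁ m₂ ha0 hm hab hvals _ hDn
  refine h.trans ?_
  have hlogx : Real.log N ≤ Real.log (2 * L * N) := Real.log_le_log hNpos hxN
  have hlogx0 : 0 < Real.log (2 * L * N) := lt_of_lt_of_le hlogpos hlogx
  have hmax0 : 0 ≤ max Cr 0 := le_max_right _ _
  calc Cr * (2 * L * N) / Real.log (2 * L * N) ^ (t + 3)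
      ≤ max Cr 0 * (2 * L * N) / Real.log (2 * L * N) ^ (t + 3) := by
        refine div_le_div_of_nonneg_right ?_ (by positivity)
        exact mul_le_mul_of_nonneg_right (le_max_left _ _) (by positivity)
    _ ≤ max Cr 0 * (2 * L * N) / Real.log N ^ (t + 3) := by
        refine div_le_div_of_nonneg_left (by positivity) (by positivity) ?_
        exact pow_le_pow_left₀ hlogpos.le hlogx _
    _ = 2 * L * max Cr 0 * N / Real.log N ^ (t + 3) := by ring

/-! ### The singles bound at one scale -/

/-- `e^{-u/16} ≥ 1/3` for `u ≤ 16` (`e ≤ 3`). [folklore] -/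
theorem third_le_exp_neg {u : ℕ} (hu16 : u ≤ 16) : (1 : ℝ) / 3 ≤ Real.exp (-((1 : ℝ) / 16 * u)) := by
  have hu : (u : ℝ) ≤ 16 := by exact_mod_cast hu16
  have h1 : Real.exp (-1) ≤ Real.exp (-((1 : ℝ) / 16 * u)) := Real.exp_le_exp.mpr (by nlinarith)
  refine le_trans ?_ h1
  rw [Real.exp_neg, div_le_iff₀ (by norm_num : (0 : ℝ) < 3), inv_mul_eq_div,
    le_div_iff₀ (Real.exp_pos 1), one_mul]
  have := Real.exp_one_lt_d9
  linarith

/-- **`SinglesDecay` at one scale.**  Given the Fundamental Lemma constant `C_FL` (dimension `2(L+t)`),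
the class-sum constant `C_r`, and a scale `N` past all thresholds (`N ≥ 16`, `log N ≥ 1`,
`N^{1/u}, N^{1/17} ≥ B₀ = L + 4t² + t + 2`, `N^{1/17} + 1 ≤ N^{1/8}`, `L N^{1/8} ≤ (2LN)^{1/4}`,
`x₀ ≤ N`, and the junk absorption `t + 1 + 2C_FL + 2 L C_r N/log^{t+3} N ≤ N/log^{t+1} N`):
`|∑_{roughTuples} (−1)^{Ω(ψ_i(n))}| ≤ 6 (1 + C_FL) 5^t e^{−u/16} β_∞ ∏_p β_p (u/log N)^t + N/log^{t+1} N`.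
[cite: FriedlanderIwaniecOpera2010, Cor. 6.10] -/
theorem singles_at_scale {κ Kd CFL : ℝ} (hCFL0 : 0 ≤ CFL)
    (hFL : ∀ A : SieveSequence, HasSieveDimension A.density κ Kd →
      ∀ x z D : ℝ, 2 ≤ z → z ≤ D → 0 ≤ A.size x →
        |A.sifted x (primesProdBelow z) - A.size x * A.densityProduct (primesProdBelow z)| ≤
          CFL * A.size x * A.densityProduct (primesProdBelow z) *
              Real.exp (-(Real.log D / Real.log z)) +
            ∑ d ∈ (primesProdBelow z).divisors.filter (fun d : ℕ => (d : ℝ) ≤ D),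
              |A.remainder d x|)
    {L : ℕ} (hκ : κ = 2 * ((L + t : ℕ) : ℝ))
    (hKd : Kd = ((2 * (L + t) + 1 : ℕ) : ℝ) ^ (2 * (L + t) + 1) *
      Real.exp (2 * ((L + t : ℕ) : ℝ) * (9 / 2 + 6 / Real.log 2)))
    {Cr x₀ : ℝ}
    (hCr : ∀ x : ℝ, x₀ ≤ x → ∀ F : Polynomial ℤ, (∀ p : ℕ, p.Prime → polyRootCountMod ![F] p ≤ L + t) →
      ∀ (a b m₁ m₂ : ℤ), a ≠ 0 → m₁ ≤ m₂ → (∀ m ∈ Icc m₁ m₂, 1 ≤ a * m + b) →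
        (∀ m ∈ Icc m₁ m₂, ((a * m + b : ℤ) : ℝ) ≤ x) →
          ∀ Dn : ℕ, ((a.natAbs * Dn : ℕ) : ℝ) ≤ x ^ (1 / 4 : ℝ) →
          ∑ d ∈ (Icc 1 Dn).filter Squarefree, ∑ s ∈ rootsMod F d,
            (1 + |∑ m ∈ (Icc m₁ m₂).filter (fun m : ℤ => m ≡ (s : ℤ) [ZMOD d]),
              (liouville (a * m + b).toNat : ℝ)|) ≤ Cr * x / Real.log x ^ (t + 3))
    {B₀ : ℝ} (hB₀ : B₀ = (L : ℝ) + 4 * t ^ 2 + t + 2)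
    {N u : ℕ} (hu4 : 4 ≤ u) (h16 : (16 : ℝ) ≤ N) (hlog1 : 1 ≤ Real.log N)
    (hyB : B₀ ≤ (N : ℝ) ^ ((1 : ℝ) / u)) (hB17 : B₀ ≤ (N : ℝ) ^ ((1 : ℝ) / 17))
    (hlevel : (N : ℝ) ^ ((1 : ℝ) / 17) + 1 ≤ (N : ℝ) ^ ((1 : ℝ) / 8))
    (hquarter : (L : ℝ) * (N : ℝ) ^ ((1 : ℝ) / 8) ≤ (2 * L * N) ^ ((1 : ℝ) / 4))
    (hx₀ : x₀ ≤ N)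
    (hjunk : ((t : ℝ) + CFL + (1 + CFL)) + 2 * L * max Cr 0 * N / Real.log N ^ (t + 3) ≤
      (N : ℝ) / Real.log N ^ (t + 1))
    {Ψ : Fin t → AffLinForm 1} (hΨ : IsNondegenerateSystem Ψ) (hL : affLinSize Ψ N ≤ L)
    {K : Set (Fin 1 → ℝ)} (hK : Convex ℝ K) (hKN : K ⊆ realBox 1 N) (i : Fin t) :
    |∑ n ∈ roughTuples Ψ K N u, (-1 : ℝ) ^ (cardFactors ((Ψ i).eval n).toNat)| ≤
      6 * (1 + CFL) * 5 ^ t * Real.exp (-(1 / 16 * (u : ℝ))) * (archFactor Ψ K * singularProduct Ψ) *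
          ((u : ℝ) / Real.log N) ^ t +
        (N : ℝ) / Real.log N ^ (t + 1) := by
  have hu1 : 1 ≤ u := by omega
  -- basic positivity
  have hNpos : (0 : ℝ) < N := by linarith
  have hN1r : (1 : ℝ) ≤ N := by linarith
  have hlogpos : 0 < Real.log N := by linarith
  have haL : ∀ k, ((Ψ k).coeff 0).natAbs ≤ L := fun k => natAbs_coeff_le_of_affLinSize_le hL k 0
  have hAF0 : 0 ≤ archFactor Ψ K := archFactor_nonneg Ψ K
  have hSP0 : 0 ≤ singularProduct Ψ :=
    ge_of_tendsto' (tendsto_singularProductPartial_holds 1 t Ψ hΨ)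
      fun x => Finset.prod_nonneg fun p _ => localFactor_nonneg Ψ p
  have hu0 : (0 : ℝ) < u := by exact_mod_cast (show 0 < u by omega)
  have hRHS0 : 0 ≤ 6 * (1 + CFL) * 5 ^ t * Real.exp (-(1 / 16 * (u : ℝ))) *
      (archFactor Ψ K * singularProduct Ψ) * ((u : ℝ) / Real.log N) ^ t := by positivity
  have hjunk0 : 0 ≤ (N : ℝ) / Real.log N ^ (t + 1) := by positivity
  -- the rough threshold `y = N^{1/u} ≥ B₀ ≥ 2`
  have ht0 : (0 : ℝ) ≤ t := Nat.cast_nonneg t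
  have hL0 : (0 : ℝ) ≤ L := Nat.cast_nonneg L
  have ht2 : (0 : ℝ) ≤ 4 * (t : ℝ) ^ 2 := by positivity
  have hB2 : (2 : ℝ) ≤ B₀ := by rw [hB₀]; linarith
  have hy2 : (2 : ℝ) ≤ (N : ℝ) ^ ((1 : ℝ) / u) := hB2.trans hyB
  have hhead_of : ∀ {y : ℝ}, B₀ ≤ y → L ≤ ⌊y⌋₊ ∧ 4 * t ^ 2 ≤ ⌊y⌋₊ ∧ 1 ≤ ⌊y⌋₊ := by
    intro y hy
    refine ⟨Nat.le_floor ?_, Nat.le_floor ?_, Nat.le_floor ?_⟩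
    · have : (L : ℝ) ≤ B₀ := by rw [hB₀]; linarith
      exact this.trans hy
    · have : ((4 * t ^ 2 : ℕ) : ℝ) ≤ B₀ := by rw [hB₀]; push_cast; linarith
      exact this.trans hy
    · have : ((1 : ℕ) : ℝ) ≤ B₀ := by rw [hB₀]; push_cast; linarith
      exact this.trans hy
  -- Case 1: a local obstruction below the threshold empties the rough tuples
  by_cases hobs : ∃ p : ℕ, p.Prime ∧ polyRootCountMod ![sysPoly Ψ] p = p
  · obtain ⟨p, hp, hρ⟩ := hobs
    have hpL : polyRootCountMod ![sysPoly Ψ] p ≤ L + t := rootCount_le_add hΨ haL hp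
    rw [hρ] at hpL
    have hpy : (p : ℝ) ≤ (N : ℝ) ^ ((1 : ℝ) / u) := by
      refine le_trans ?_ hyB
      have h1 : (p : ℝ) ≤ (L : ℝ) + t := by exact_mod_cast hpL
      rw [hB₀]; linarith
    have hempty := roughTuples_eq_empty_of_obstructed Ψ hp hρ hpy hy2 K
    rw [hempty, Finset.sum_empty, abs_zero]
    exact add_nonneg hRHS0 hjunk0
  -- Case 2: no local obstruction
  push Not at hobs
  have hlt : ∀ p : ℕ, p.Prime → polyRootCountMod ![sysPoly Ψ] p < p := fun p hp =>
    lt_of_le_of_ne (polyRootCountMod_le _ p) (hobs p hp)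
  have hdim : HasSieveDimension (rootDensity (sysPoly Ψ)) κ Kd := by
    rw [hκ, hKd]; exact hasSieveDimension_sysPoly hΨ haL hlt
  -- the interval of positive lattice points
  obtain ⟨m₁, m₂, hI, hcardI⟩ := exists_interval Ψ hK hKN
  have hIpos : ∀ m ∈ Icc m₁ m₂, ∀ k, 1 ≤ (Ψ k).eval (fun _ => m) := fun m hm => ((hI m).mp hm).2.2
  rw [roughTuples_sum_eq Ψ hy2 K i hI]
  rcases lt_or_ge m₂ m₁ with hm | hm
  · -- empty interval
    rw [Finset.Icc_eq_empty (not_le.mpr hm), Finset.filter_empty, Finset.sum_empty, abs_zero]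
    exact add_nonneg hRHS0 hjunk0
  -- the remainder
  have hRem := rem_le hCr hΨ hL h16 hlog1 hx₀ hquarter hm
    (fun m hm => ⟨((hI m).mp hm).1, ((hI m).mp hm).2.2⟩) i
  -- the two regimes
  rcases le_or_gt 17 u with hu17 | hu16
  · -- `u ≥ 17`: the Fundamental Lemma at `z = ⌊N^{1/u}⌋ + 1 ≤ N^{1/17} + 1 ≤ N^{1/8}`
    have hzD : (((⌊(N : ℝ) ^ ((1 : ℝ) / u)⌋₊ + 1 : ℕ) : ℝ)) ≤ (N : ℝ) ^ ((1 : ℝ) / 8) := by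
      push_cast
      have h1 : (⌊(N : ℝ) ^ ((1 : ℝ) / u)⌋₊ : ℝ) ≤ (N : ℝ) ^ ((1 : ℝ) / u) :=
        Nat.floor_le (by positivity)
      have h2 : (N : ℝ) ^ ((1 : ℝ) / u) ≤ (N : ℝ) ^ ((1 : ℝ) / 17) := by
        refine Real.rpow_le_rpow_of_exponent_le hN1r ?_
        have : (17 : ℝ) ≤ u := by exact_mod_cast hu17
        rw [div_le_div_iff₀ hu0 (by norm_num)]
        linarith
      linarith
    have key := singles_largeU hCFL0 hFL hΨ haL hdim hIpos hAF0 hcardI hu1 hy2 (hhead_of hyB) hzD i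
      hRem
    refine key.trans ?_
    have hX0 : 0 ≤ Real.exp (-((1 : ℝ) / 16 * u)) * (archFactor Ψ K * singularProduct Ψ) *
        ((u : ℝ) / Real.log N) ^ t := by positivity
    have hC2 : 2 * CFL ≤ 6 * (1 + CFL) * 5 ^ t := by
      have h5 : (1 : ℝ) ≤ 5 ^ t := one_le_pow₀ (by norm_num)
      nlinarith
    have hmain : 2 * CFL * Real.exp (-((1 : ℝ) / 16 * u)) * (archFactor Ψ K * singularProduct Ψ) *
        ((u : ℝ) / Real.log N) ^ t ≤
        6 * (1 + CFL) * 5 ^ t * Real.exp (-(1 / 16 * (u : ℝ))) * (archFactor Ψ K * singularProduct Ψ) *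
          ((u : ℝ) / Real.log N) ^ t := by
      have := mul_le_mul_of_nonneg_right hC2 hX0
      calc _ = 2 * CFL * (Real.exp (-((1 : ℝ) / 16 * u)) * (archFactor Ψ K * singularProduct Ψ) *
            ((u : ℝ) / Real.log N) ^ t) := by ring
        _ ≤ 6 * (1 + CFL) * 5 ^ t * (Real.exp (-((1 : ℝ) / 16 * u)) *
            (archFactor Ψ K * singularProduct Ψ) * ((u : ℝ) / Real.log N) ^ t) := this
        _ = _ := by ring
    have hrest : (t : ℝ) + CFL + 2 * L * max Cr 0 * N / Real.log N ^ (t + 3) ≤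
        (N : ℝ) / Real.log N ^ (t + 1) := by linarith
    linarith
  · -- `4 ≤ u ≤ 16`: count the `N^{1/17}`-sifted points
    have hu16' : u ≤ 16 := by omega
    have hy2' : (2 : ℝ) ≤ (N : ℝ) ^ ((1 : ℝ) / 17) := hB2.trans hB17
    have hzD : (((⌊(N : ℝ) ^ ((1 : ℝ) / 17)⌋₊ + 1 : ℕ) : ℝ)) ≤ (N : ℝ) ^ ((1 : ℝ) / 8) := by
      push_cast
      have h1 : (⌊(N : ℝ) ^ ((1 : ℝ) / 17)⌋₊ : ℝ) ≤ (N : ℝ) ^ ((1 : ℝ) / 17) :=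
        Nat.floor_le (by positivity)
      linarith
    have key := singles_smallU hCFL0 hFL hΨ haL hdim hIpos hAF0 hcardI hu1 hu16' hN1r hy2'
      (hhead_of hB17) hzD i hRem
    refine key.trans ?_
    have hmain : 2 * (1 + CFL) * (archFactor Ψ K * singularProduct Ψ) * ((17 : ℝ) / Real.log N) ^ t ≤
        6 * (1 + CFL) * 5 ^ t * Real.exp (-(1 / 16 * (u : ℝ))) * (archFactor Ψ K * singularProduct Ψ) *
          ((u : ℝ) / Real.log N) ^ t := by
      have he := third_le_exp_neg hu16'
      have hu4' : (4 : ℝ) ≤ u := by exact_mod_cast hu4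
      have h17 : (17 : ℝ) ^ t ≤ 20 ^ t := pow_le_pow_left₀ (by norm_num) (by norm_num) t
      have h4t : (4 : ℝ) ^ t ≤ (u : ℝ) ^ t := pow_le_pow_left₀ (by norm_num) hu4' t
      have hM0 : 0 ≤ archFactor Ψ K * singularProduct Ψ / Real.log N ^ t := by positivity
      calc 2 * (1 + CFL) * (archFactor Ψ K * singularProduct Ψ) * ((17 : ℝ) / Real.log N) ^ t
          = 2 * (1 + CFL) * 17 ^ t * (archFactor Ψ K * singularProduct Ψ / Real.log N ^ t) := by
            rw [div_pow]; ring
        _ ≤ 2 * (1 + CFL) * 20 ^ t * (archFactor Ψ K * singularProduct Ψ / Real.log N ^ t) := by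
            gcongr
        _ = 6 * (1 + CFL) * 5 ^ t * (1 / 3) * 4 ^ t *
              (archFactor Ψ K * singularProduct Ψ / Real.log N ^ t) := by
            rw [show (20 : ℝ) ^ t = 5 ^ t * 4 ^ t by rw [← mul_pow]; norm_num]; ring
        _ ≤ 6 * (1 + CFL) * 5 ^ t * Real.exp (-(1 / 16 * (u : ℝ))) * (u : ℝ) ^ t *
              (archFactor Ψ K * singularProduct Ψ / Real.log N ^ t) := by
            gcongr
        _ = _ := by rw [div_pow]; ring
    have hrest : (1 + CFL) + 2 * L * max Cr 0 * N / Real.log N ^ (t + 3) ≤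
        (N : ℝ) / Real.log N ^ (t + 1) := by linarith
    linarith

/-! ### The stub -/

/-- **`SinglesDecay`** (registered stub `stub_singlesDecay` of the line `nlc-cells-absolute-clip`, crux
`AbsoluteUpgrade`, stmt-Parity-14116): for `t` forms there is `c = 1/16` such that for every `A`,
uniformly for `N ≥ N₀(t, L, A)`, `4 ≤ u ≤ A log log log N`, non-degenerate `Ψ` with `‖Ψ‖_N ≤ L`,
convex `K ⊆ [-N, N]` and every coordinate `i`,
`|∑_{n ∈ roughTuples Ψ K N u} (−1)^{Ω(ψ_i(n))}| ≤ C e^{−u/16} β_∞ ∏_p β_p (u/log N)^t + N/log^{t+1} N`.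
Proof: the rough tuples are the rough points of the integer interval of positive lattice points of
`K` (`≤ β_∞ + 1` points); a local obstruction below `N^{1/u}` empties them; otherwise the root density
of `F_Ψ` has sieve dimension `2(L+t)` and (i) for `u ≥ 17` the Fundamental Lemma at
`z = ⌊N^{1/u}⌋ + 1 ≤ D = N^{1/8}` on the two sign classes of `λ(ψ_i)` — whose main terms cancel —
gives `2 C_FL e^{−u/16} β_∞ ∏β_p (u/log N)^t` plus Liouville class sums bounded by Bombieri–Vinogradov
for `λ` (`classSums_le`, `≪ N/log^{t+3} N`), (ii) for `u ≤ 16` the number of `N^{1/17}`-sifted points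
suffices.  Unconditional. [cite: FriedlanderIwaniecOpera2010, Cor. 6.10] -/
theorem stub_singlesDecay : SinglesDecay := by
  intro t L ht
  refine ⟨1 / 16, by norm_num, fun A => ?_⟩
  -- sieve constants depending on `t, L` only
  obtain ⟨CFL, hCFLpos, hFL⟩ := SieveSequence.fundamental_lemma_uniform_holds (2 * ((L + t : ℕ) : ℝ))
    (((2 * (L + t) + 1 : ℕ) : ℝ) ^ (2 * (L + t) + 1) *
      Real.exp (2 * ((L + t : ℕ) : ℝ) * (9 / 2 + 6 / Real.log 2)))
  obtain ⟨Cr, x₀, hCr⟩ := classSums_le (L + t) t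
  -- thresholds in `N`
  obtain ⟨N₁, hN₁⟩ := exists_forall_le_rpow_inv A ((L : ℝ) + 4 * t ^ 2 + t + 2)
  have hev : ∀ᶠ N : ℕ in atTop, ((16 : ℝ) ≤ N ∧ 1 ≤ Real.log N) ∧
      (((L : ℝ) + 4 * t ^ 2 + t + 2 ≤ (N : ℝ) ^ ((1 : ℝ) / 17)) ∧
      (((N : ℝ) ^ ((1 : ℝ) / 17) + 1 ≤ (N : ℝ) ^ ((1 : ℝ) / 8)) ∧
      ((max (L : ℝ) 1 * (N : ℝ) ^ ((1 : ℝ) / 8) ≤ (2 * max (L : ℝ) 1 * N) ^ ((1 : ℝ) / 4)) ∧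
      ((x₀ ≤ (N : ℝ)) ∧
      (((t : ℝ) + CFL + (1 + CFL)) + 2 * L * max Cr 0 * N / Real.log N ^ (t + 3) ≤
        (N : ℝ) / Real.log N ^ (t + 1)))))) :=
    eventually_basic.and ((eventually_rpow_ge _ (by norm_num)).and (eventually_level.and
      ((eventually_quarter (lt_max_of_lt_right one_pos)).and ((eventually_ge_real x₀).and
        (eventually_junk t _ _)))))
  obtain ⟨N₂, hN₂⟩ := eventually_atTop.mp hev
  refine ⟨6 * (1 + CFL) * 5 ^ t, max N₁ N₂, fun N hN u hu4 huA Ψ hΨ hL K hK hKN i => ?_⟩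
  obtain ⟨⟨h16, hlog1⟩, hB17, hlevel, hquarter, hx₀, hjunk⟩ := hN₂ N (le_trans (le_max_right _ _) hN)
  have hyB := hN₁ N (le_trans (le_max_left _ _) hN) u (by omega) huA
  have hL1 : (1 : ℝ) ≤ L := one_le_of_affLinSize_le Ψ hΨ hL i
  rw [max_eq_left hL1] at hquarter
  exact singles_at_scale hCFLpos.le hFL rfl rfl hCr rfl hu4 h16 hlog1 hyB hB17 hlevel hquarter hx₀ hjunk
    hΨ hL hK hKN i

end Summit.Parity.GeneralizedHardyLittlewood.Theorems.AbsoluteUpgrade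

end
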